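import Summits.QuantumFields.BalabanUV.T4Continuum.Support.NE7LoewnerDiagramPlaquette

/-!
# NE7LoewnerDiagramBVIntensive — row NE7 (node U5), route «PAIR-CAUCHY» ∕ supplier LÖW (ROUTES-NE7.md §L2.2 B3): the
# INTENSIVE form B3-vol′ of the diagram-BV lemma — the head TRACE of `NE7LoewnerDiagramBV` replaced by ONE DIAGONAL
# DATUM (a bound `δ` on the head kernel's diagonal), so that the total variation of a diagram along a Löwner chain is
# `≤ |E|·δ^{|E|}·Σ_x ‖w x‖` and the volume enters through `‖w‖₁` alone, once; instances on the torus plaquette chains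

Cell `pub-balaban`, rung (B)+1 sub-cell t4, lineage `b2b-balaban-t4-ne7-p2` (CRUX PROVER NE7 #2 under the
coordinator ruling «YM redirect», 2026-08-21; generation 54; texts: the crux refuter's `HOME/b2b-balaban-t4-ne7-refuter/
PRICING-NE7.md` v8 §44 «LOCATED SHARPENING B3-vol′ (an OFFER …): the trace is where VOLUME enters the bound needlessly …
TV ≤ |E|·δ^{|E|}·‖w‖₁ — INTENSIVE when w is localized» (falsifier F31 (i): 0∕400 violations),
`HOME/t4/b2b-balaban-t4-ne7-p2/g54/ROUTE2-NE7-P2.md` v1.9 §12, and the HONEST LIMITS «B3-vol: constants volume-EXTENSIVE»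
of the headers of `Support/NE7LoewnerDiagramBV` ∕ `Support/NE7LoewnerDiagramPlaquette`.  HONEST FRAMING (page 1):
FIXED FINITE T⁴, rung (B)+1 = existence AND uniqueness of the `ε = L^{−K} → 0` limit of unit-scale averaged expectations,
CONDITIONAL on BetaPertH and the nine spine estimates (0/9 proved); NOT infinite volume, NOT a mass gap, NOT the Clay
problem.  NE7 is NOT PRINTED in [Balaban1984PropagatorsI]–[Balaban1989LargeFieldII] and NOT proved here.  Everything below
is [folklore] finite-dimensional linear algebra (2×2 minors of PSD matrices) and real analysis over HYPOTHESIS SHAPES (an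
abstract Löwner chain of complex matrices) plus instances on TREE chains; no definition, no cite tag, nothing printed
asserted, no `sorry`.

WHY.  `NE7LoewnerDiagramBV.tsum_norm_diagram_sub_le` bounds the total variation of a diagram functional
`F(C) = Σ_x w x·Π_e C(x_{s(e)}, x_{t(e)})` along a Löwner chain `P k₀ ≥ P (k₀+1) ≥ … ≥ 0` by `|E|·(re tr P k₀)^{|E|}·‖w‖₁`.
On the torus plaquette chain the head trace is the SUM of all single-plaquette variances (`≍ #plaquettes`), so a diagram
with `|E|` edges inherits `vol^{|E|}` although its entries never exceed ONE variance: for PSD `P`, `‖P a b‖ ≤ ½(re P a a +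
re P b b)` (`GAN24/MonotoneTraceNorm.norm_apply_le_half_diag`), the diagonals only DECREASE along the chain, and the
per-entry variation telescopes against half-diagonals (`NE7LoewnerDiagramBV.sum_norm_apply_sub_succ_le'`).  Hence with
ONE DIAGONAL DATUM `δ` (`re (P k₀) a a ≤ δ` for all `a`) every entry of every `P j`, `j ≥ k₀`, is `≤ δ`, every entry varies
by `≤ δ` in total, and the Leibniz telescoping of `NE7LoewnerDiagramBV.norm_diagram_sub_le` gives the INTENSIVE bound
  `Σ_{j ≥ k₀} ‖F(P j) − F(P (j+1))‖ ≤ |E|·δ^{|E|}·Σ_x ‖w x‖`                                   (`tsum_norm_diagram_sub_le_of_diag_datum`)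
— a diagram with `O(1)` external legs (localized `w`, `‖w‖₁ = O(1)`) costs `O(1)`, not `O(vol^{|E|})`.  Where it matters
(PRICING-NE7 v8 §44): any consumer of the (E♭) ∕ node-U5 budget `vol·δ_K` that wants `δ_K` SMALL PER UNIT VOLUME must not
inherit `(tr P)^{|E|}`; with B3-vol′ the volume is carried by `‖w‖₁` alone.  The same replacement is made in the ONE-DATUM
bands of `NE7LoewnerDiagramPlaquette` ((MONO-K)₂ for diagrams): the trace LOST after `k₀` (`re tr(P k₀ − P j) ≤ η₀`) is
replaced by the largest DIAGONAL DROP (`re (P k₀ − P j) a a ≤ η₀` for all `a`) — again a 2×2-minor remark.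

WHAT IS PROVED ([folklore]; `P : ℕ → Matrix n n ℂ`, `hstep : ∀ j ≥ k₀, (P j − P (j+1)).PosSemidef`,
`hpos : ∀ j ≥ k₀, (P j).PosSemidef`; indices written `j + k₀` as in `NE7LoewnerDiagramBV`).
§1 ENTRIES FROM A DIAGONAL DATUM: `re_diag_le_re_diag_head` (diagonals decrease along the chain); `diag_datum_nonneg`
   (`0 ≤ δ` when the index type is nonempty); `exists_max_diag_datum` (the canonical datum `δ = max_a re (P k₀) a a` exists
   and is `≤ re tr P k₀` — the intensive bound is never worse than the extensive one); **`norm_apply_le_of_diag_datum`**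
   (`‖P j a b‖ ≤ δ` for all `j ≥ k₀`); `sum_norm_apply_sub_succ_le_of_diag_datum` ∕ `tsum_…` (per-entry variation `≤ δ`);
   **`norm_sub_apply_le_of_diag_dev`** (ONE DIAGONAL-DROP DATUM `η₀` ⟹ every entry of `P j − P j′`, `j, j′ ≥ k₀`, within `η₀`
   — `GAN24/MonotoneLoewner.norm_sub_apply_le_of_steps` with the trace replaced by the diagonal).
§2 DIAGRAMS: **`sum_norm_diagram_sub_le_of_diag_datum`**, **`tsum_norm_diagram_sub_le_of_diag_datum`** (B3-vol′:
   TV `≤ |E|·δ^{|E|}·‖w‖₁`); `norm_diagram_sub_le_of_dev_of_diag_datum` (band `|E|·δ^{|E|−1}·η·‖w‖₁` from an entry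
   deviation `η`); **`norm_diagram_sub_le_of_diag_dev`**, `norm_diagram_sub_lim_le_of_diag_dev` (bands between two depths
   and to the limit from the diagonal-drop datum).  `0 ≤ δ` is carried as an explicit binder (as `hγ` in
   `NE7LoewnerDiagramBV.norm_diagram_sub_le`); it is `diag_datum_nonneg` whenever `n` is nonempty.
§3 INSTANCES on gan24-p4's UNCONDITIONAL torus plaquette-covariance chain `Beta/GAN24/MonotoneTorusPlaquette.plaqCov`
   (`plaqCov_antitone_step`, `plaqCov_posSemidef` — no binder): `norm_plaqCov_apply_le_of_variance` (every covariance
   entry at every level `j ≥ k₀` is `≤` any bound `δ` on the level-`k₀` SINGLE-PLAQUETTE VARIANCES),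
   **`tsum_norm_diagram_plaqCov_sub_le_of_variance`** (TV `≤ |E|·δ^{|E|}·‖w‖₁`, `δ` a bound on the coarsest-level
   variances), **`norm_diagram_plaqCov_sub_le_of_variance_drop`** ∕ `…_sub_lim_le_…` ((MONO-K)₂ for plaquette diagrams
   from the single-plaquette variance DROP `η₀` after `k₀`: band `|E|·δ^{|E|−1}·η₀·‖w‖₁`).
§4 The same three on the SOFT (Gaussian-weighted) constraint chain `Beta/GAN24/MonotoneTorusSoft.softPlaqCov` (only
   binder `0 ≤ a′`).

HONEST LIMITS.  (i) This sharpens OUR lemma's constant; it asserts nothing about Bałaban's propagators forming such a chain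
across runs (LÖW's open half; rider LÖW-b₀(k) dormant), nothing printed.  (ii) `‖w‖₁` still carries the volume for
EXTENSIVE sums — the 2-edge-connected ∕ exponential-decay refinement of §L2.2 B3 (volume-UNIFORM per-unit-volume constants
from printed decay) is NOT done; at rung (B)+1 the read-out torus is a fixed finite set.  (iii) LÖW-res ∕ §L2.2 B4 (β⁰ is
a background derivative — B12 p. 264 (1.20)–(1.22) — not a transverse read-out) untouched.  (iv) `plaqCov`'s ∕
`softPlaqCov`'s own scope (torus avatar, abelian ∕ linearised layer, `U = 1`) inherited verbatim.  NOT NE7 (spine 0/9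
unchanged), NOT BetaPertH, NOT summit progress.  HONEST DEPENDENCY: continuum YM on T⁴ ⇐ BetaPertH ∧ nine spine estimates
(0/9 proved); BetaPertH ⇐ (D1) ∧ (D4) ∧ CAP+tail; G-an2-4 gates asym, D1 and NE2/3/4.
-/

noncomputable section

open Finset Filter Topology
open scoped BigOperators ComplexOrder

namespace Summit.QuantumFields.BalabanUV.T4Continuum.NE7LoewnerDiagramBVIntensive

open Summit.QuantumFields.BalabanUV.Beta.GAN24.MonotoneLoewner
  (re_diag_nonneg re_diag_le_re_trace posSemidef_sub_of_steps)
open Summit.QuantumFields.BalabanUV.Beta.GAN24.MonotoneTraceNorm (norm_apply_le_half_diag)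
open Summit.QuantumFields.BalabanUV.T4Continuum.NE7LoewnerDiagramBV
  (diagram norm_diagram_sub_le sum_norm_apply_sub_succ_le' exists_tendsto_diagram)
open Summit.QuantumFields.BalabanUV.T4Continuum.NE7LoewnerDiagramPlaquette (norm_diagram_sub_le_of_entry_dev)

/-! ## §1 Entries of a Löwner chain from ONE diagonal datum -/

section Entries

variable {n : Type*} {P : ℕ → Matrix n n ℂ} {k₀ : ℕ}

/-- THE DIAGONALS ONLY DECREASE along a chain of PSD steps: `re (P j) a a ≤ re (P k₀) a a` for `j ≥ k₀`. [folklore] -/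
theorem re_diag_le_re_diag_head (hstep : ∀ j, k₀ ≤ j → (P j - P (j + 1)).PosSemidef) {j : ℕ} (hj : k₀ ≤ j)
    (a : n) : (P j a a).re ≤ (P k₀ a a).re := by
  have h := re_diag_nonneg (posSemidef_sub_of_steps hstep k₀ j le_rfl hj) a
  rw [Matrix.sub_apply, Complex.sub_re] at h
  linarith

/-- A diagonal datum of a PSD head kernel is nonnegative as soon as the index type is nonempty. [folklore] -/
theorem diag_datum_nonneg [Nonempty n] (hpos : ∀ j, k₀ ≤ j → (P j).PosSemidef) {δ : ℝ}
    (hδ : ∀ a, (P k₀ a a).re ≤ δ) : 0 ≤ δ := by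
  obtain ⟨a⟩ := ‹Nonempty n›
  exact (re_diag_nonneg (hpos k₀ le_rfl) a).trans (hδ a)

/-- THE CANONICAL DATUM: on a finite nonempty index type the largest head diagonal `δ = max_a re (P k₀) a a` is a diagonal
datum, is nonnegative, and is AT MOST THE HEAD TRACE — the intensive constant is never worse than the extensive one of
`NE7LoewnerDiagramBV`. [folklore] -/
theorem exists_max_diag_datum [Fintype n] [Nonempty n] (hpos : ∀ j, k₀ ≤ j → (P j).PosSemidef) :
    ∃ δ : ℝ, (∀ a, (P k₀ a a).re ≤ δ) ∧ 0 ≤ δ ∧ δ ≤ (P k₀).trace.re := by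
  refine ⟨univ.sup' univ_nonempty fun a => (P k₀ a a).re, fun a => le_sup' (fun a => (P k₀ a a).re) (mem_univ a),
    ?_, ?_⟩
  · obtain ⟨a⟩ := ‹Nonempty n›
    exact (re_diag_nonneg (hpos k₀ le_rfl) a).trans (le_sup' (fun a => (P k₀ a a).re) (mem_univ a))
  · obtain ⟨a, _, ha⟩ := exists_mem_eq_sup' (univ_nonempty (α := n)) fun a => (P k₀ a a).re
    rw [ha]
    exact re_diag_le_re_trace (hpos k₀ le_rfl) a

/-- **INTENSIVE UNIFORM ENTRY BOUND**: with a diagonal datum `re (P k₀) a a ≤ δ` (all `a`), `‖P j a b‖ ≤ δ` for every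
`j ≥ k₀` and all entries — the 2×2 minor `‖P j a b‖ ≤ ½(re P j a a + re P j b b)` and §1's monotonicity of the diagonals;
replaces `NE7LoewnerDiagramBV.norm_apply_le_re_trace_head`. [folklore] -/
theorem norm_apply_le_of_diag_datum (hstep : ∀ j, k₀ ≤ j → (P j - P (j + 1)).PosSemidef)
    (hpos : ∀ j, k₀ ≤ j → (P j).PosSemidef) {δ : ℝ} (hδ : ∀ a, (P k₀ a a).re ≤ δ) {j : ℕ} (hj : k₀ ≤ j)
    (a b : n) : ‖P j a b‖ ≤ δ := by
  have h := norm_apply_le_half_diag (hpos j hj) a b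
  have ha := (re_diag_le_re_diag_head hstep hj a).trans (hδ a)
  have hb := (re_diag_le_re_diag_head hstep hj b).trans (hδ b)
  linarith

/-- PER-ENTRY VARIATION FROM THE DIAGONAL DATUM: `Σ_{j<K} ‖P(j+k₀) a b − P(j+k₀+1) a b‖ ≤ δ` for every `K` (the partial sums
telescope against half-diagonals, `NE7LoewnerDiagramBV.sum_norm_apply_sub_succ_le'`). [folklore] -/
theorem sum_norm_apply_sub_succ_le_of_diag_datum (hstep : ∀ j, k₀ ≤ j → (P j - P (j + 1)).PosSemidef)
    (hpos : ∀ j, k₀ ≤ j → (P j).PosSemidef) {δ : ℝ} (hδ : ∀ a, (P k₀ a a).re ≤ δ) (a b : n) (K : ℕ) :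
    ∑ j ∈ range K, ‖P (j + k₀) a b - P (j + k₀ + 1) a b‖ ≤ δ := by
  have h := sum_norm_apply_sub_succ_le' hstep hpos a b K
  linarith [hδ a, hδ b]

/-- … hence total variation of every entry `≤ δ`. [folklore] -/
theorem tsum_norm_apply_sub_succ_le_of_diag_datum (hstep : ∀ j, k₀ ≤ j → (P j - P (j + 1)).PosSemidef)
    (hpos : ∀ j, k₀ ≤ j → (P j).PosSemidef) {δ : ℝ} (hδ : ∀ a, (P k₀ a a).re ≤ δ) (a b : n) :
    ∑' j, ‖P (j + k₀) a b - P (j + k₀ + 1) a b‖ ≤ δ :=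
  Real.tsum_le_of_sum_range_le (fun _ => norm_nonneg _)
    (sum_norm_apply_sub_succ_le_of_diag_datum hstep hpos hδ a b)

/-- **ONE DIAGONAL-DROP DATUM ⟹ PAIRWISE ENTRYWISE BOUND (intensive (MONO-K)₂ for entries).**  A chain of PSD steps from
`k₀` and a bound `η₀` on the largest DIAGONAL LOST after `k₀` (`re (P k₀ − P j) a a ≤ η₀` for all `j ≥ k₀` and all `a`)
give `‖(P j − P j′) a b‖ ≤ η₀` for all `j, j′ ≥ k₀` and all entries — `GAN24/MonotoneLoewner.norm_sub_apply_le_of_steps`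
with the trace replaced by the diagonal (2×2 minor of the PSD difference `P j − P j′`, whose diagonal is at most the
diagonal drop from `k₀`). [folklore] -/
theorem norm_sub_apply_le_of_diag_dev (hstep : ∀ j, k₀ ≤ j → (P j - P (j + 1)).PosSemidef) {η₀ : ℝ}
    (hdat : ∀ j, k₀ ≤ j → ∀ a, ((P k₀ - P j) a a).re ≤ η₀) :
    ∀ j j', k₀ ≤ j → k₀ ≤ j' → ∀ a b, ‖(P j - P j') a b‖ ≤ η₀ := by
  -- first for ordered pairs
  have key : ∀ j j', k₀ ≤ j → j ≤ j' → ∀ a b, ‖(P j - P j') a b‖ ≤ η₀ := by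
    intro j j' hj hjj' a b
    have h1 := norm_apply_le_half_diag (posSemidef_sub_of_steps hstep j j' hj hjj') a b
    have h2 : ∀ c, ((P j - P j') c c).re ≤ η₀ := by
      intro c
      have h0 := re_diag_nonneg (posSemidef_sub_of_steps hstep k₀ j le_rfl hj) c
      have h3 := hdat j' (hj.trans hjj') c
      simp only [Matrix.sub_apply, Complex.sub_re] at h0 h3 ⊢
      linarith
    linarith [h2 a, h2 b]
  intro j j' hj hj' a b
  rcases le_total j j' with h | h
  · exact key j j' hj h a b
  · rw [← norm_neg, ← Matrix.neg_apply, neg_sub]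
    exact key j' j hj' h a b

end Entries

/-! ## §2 Diagrams: B3-vol′ — total variation `≤ |E|·δ^{|E|}·‖w‖₁`, and the intensive one-datum bands -/

section Diagrams

variable {ε ι n : Type*} [Fintype ε] [DecidableEq ε] [Fintype ι] [DecidableEq ι] [Fintype n]
variable {P : ℕ → Matrix n n ℂ} {k₀ : ℕ}

/-- **B3-vol′, PARTIAL TOTAL VARIATION**: along a Löwner chain of PSD kernels with a diagonal datum `re (P k₀) a a ≤ δ`
(`0 ≤ δ`), `Σ_{j<K} ‖F(P(j+k₀)) − F(P(j+k₀+1))‖ ≤ |E|·δ^{|E|}·Σ_x ‖w x‖` for every diagram `F = diagram src tgt w` —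
one difference edge per Leibniz term (its variation `≤ δ` by §1), the other `|E| − 1` edges bounded by `δ`
(`norm_apply_le_of_diag_datum`).  The volume enters ONLY through `Σ_x ‖w x‖`. [folklore] -/
theorem sum_norm_diagram_sub_le_of_diag_datum (hstep : ∀ j, k₀ ≤ j → (P j - P (j + 1)).PosSemidef)
    (hpos : ∀ j, k₀ ≤ j → (P j).PosSemidef) {δ : ℝ} (hδ0 : 0 ≤ δ) (hδ : ∀ a, (P k₀ a a).re ≤ δ)
    (src tgt : ε → ι) (w : (ι → n) → ℂ) (K : ℕ) :
    ∑ j ∈ range K, ‖diagram src tgt w (P (j + k₀)) - diagram src tgt w (P (j + k₀ + 1))‖ ≤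
      (Fintype.card ε : ℝ) * δ ^ Fintype.card ε * ∑ x : ι → n, ‖w x‖ := by
  -- (o) the exponent bookkeeping `|E|·δ^{|E|−1}·δ = |E|·δ^{|E|}` (both sides vanish when `|E| = 0`)
  have hpow : (Fintype.card ε : ℝ) * δ ^ (Fintype.card ε - 1) * δ = (Fintype.card ε : ℝ) * δ ^ Fintype.card ε := by
    rcases Nat.eq_zero_or_pos (Fintype.card ε) with h0 | hp
    · simp [h0]
    · rw [mul_assoc, ← pow_succ, Nat.sub_add_cancel hp]
  -- (i) one step, for each `j`, with all entries bounded by `δ`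
  have hj : ∀ j, ‖diagram src tgt w (P (j + k₀)) - diagram src tgt w (P (j + k₀ + 1))‖ ≤
      δ ^ (Fintype.card ε - 1) * ∑ x : ι → n, ‖w x‖ *
        ∑ e, ‖P (j + k₀) (x (src e)) (x (tgt e)) - P (j + k₀ + 1) (x (src e)) (x (tgt e))‖ :=
    fun j => norm_diagram_sub_le src tgt w hδ0
      (fun a b => norm_apply_le_of_diag_datum hstep hpos hδ (Nat.le_add_left k₀ j) a b)
      (fun a b => norm_apply_le_of_diag_datum hstep hpos hδ ((Nat.le_add_left k₀ j).trans (Nat.le_succ _)) a b)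
  -- (ii) the entry increments sum, per edge, to at most `δ`
  have hent : ∀ (x : ι → n) (e : ε),
      ∑ j ∈ range K, ‖P (j + k₀) (x (src e)) (x (tgt e)) - P (j + k₀ + 1) (x (src e)) (x (tgt e))‖ ≤ δ :=
    fun x e => sum_norm_apply_sub_succ_le_of_diag_datum hstep hpos hδ (x (src e)) (x (tgt e)) K
  -- (iii) assemble: swap the sums
  calc ∑ j ∈ range K, ‖diagram src tgt w (P (j + k₀)) - diagram src tgt w (P (j + k₀ + 1))‖
      ≤ ∑ j ∈ range K, δ ^ (Fintype.card ε - 1) * ∑ x : ι → n, ‖w x‖ *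
          ∑ e, ‖P (j + k₀) (x (src e)) (x (tgt e)) - P (j + k₀ + 1) (x (src e)) (x (tgt e))‖ :=
        sum_le_sum fun j _ => hj j
    _ = δ ^ (Fintype.card ε - 1) * ∑ x : ι → n, ‖w x‖ * ∑ e, ∑ j ∈ range K,
          ‖P (j + k₀) (x (src e)) (x (tgt e)) - P (j + k₀ + 1) (x (src e)) (x (tgt e))‖ := by
        rw [← mul_sum, sum_comm]
        congr 1
        refine sum_congr rfl fun x _ => ?_
        rw [← mul_sum, sum_comm]
    _ ≤ δ ^ (Fintype.card ε - 1) * ∑ x : ι → n, ‖w x‖ * ∑ _e : ε, δ := by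
        gcongr with x _ e _
        exact hent x e
    _ = (Fintype.card ε : ℝ) * δ ^ (Fintype.card ε - 1) * δ * ∑ x : ι → n, ‖w x‖ := by
        simp only [sum_const, card_univ, ← sum_mul]
        ring
    _ = (Fintype.card ε : ℝ) * δ ^ Fintype.card ε * ∑ x : ι → n, ‖w x‖ := by rw [hpow]

/-- **B3-vol′ — THE INTENSIVE DIAGRAM-BV BOUND**: `Σ_j ‖F(P(j+k₀)) − F(P(j+k₀+1))‖ ≤ |E|·δ^{|E|}·Σ_x ‖w x‖` for every
diagonal datum `δ ≥ re (P k₀) a a` (`0 ≤ δ`); summability itself is `NE7LoewnerDiagramBV.summable_norm_diagram_sub`.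
[folklore] -/
theorem tsum_norm_diagram_sub_le_of_diag_datum (hstep : ∀ j, k₀ ≤ j → (P j - P (j + 1)).PosSemidef)
    (hpos : ∀ j, k₀ ≤ j → (P j).PosSemidef) {δ : ℝ} (hδ0 : 0 ≤ δ) (hδ : ∀ a, (P k₀ a a).re ≤ δ)
    (src tgt : ε → ι) (w : (ι → n) → ℂ) :
    ∑' j, ‖diagram src tgt w (P (j + k₀)) - diagram src tgt w (P (j + k₀ + 1))‖ ≤
      (Fintype.card ε : ℝ) * δ ^ Fintype.card ε * ∑ x : ι → n, ‖w x‖ :=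
  Real.tsum_le_of_sum_range_le (fun _ => norm_nonneg _)
    (sum_norm_diagram_sub_le_of_diag_datum hstep hpos hδ0 hδ src tgt w)

/-- INTENSIVE BAND FROM AN ENTRY DEVIATION: with the diagonal datum `δ` and all entries of `P j − P j′` (`j, j′ ≥ k₀`) of
norm `≤ η`, `‖F(P j) − F(P j′)‖ ≤ |E|·δ^{|E|−1}·η·Σ_x ‖w x‖` (`NE7LoewnerDiagramPlaquette.norm_diagram_sub_le_of_entry_dev`
with the uniform entry bound `δ`). [folklore] -/
theorem norm_diagram_sub_le_of_dev_of_diag_datum (hstep : ∀ j, k₀ ≤ j → (P j - P (j + 1)).PosSemidef)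
    (hpos : ∀ j, k₀ ≤ j → (P j).PosSemidef) {δ : ℝ} (hδ0 : 0 ≤ δ) (hδ : ∀ a, (P k₀ a a).re ≤ δ) {j j' : ℕ}
    (hj : k₀ ≤ j) (hj' : k₀ ≤ j') {η : ℝ} (hdev : ∀ a b, ‖(P j - P j') a b‖ ≤ η) (src tgt : ε → ι)
    (w : (ι → n) → ℂ) :
    ‖diagram src tgt w (P j) - diagram src tgt w (P j')‖ ≤
      (Fintype.card ε : ℝ) * δ ^ (Fintype.card ε - 1) * η * ∑ x : ι → n, ‖w x‖ :=
  norm_diagram_sub_le_of_entry_dev src tgt w hδ0 (fun a b => norm_apply_le_of_diag_datum hstep hpos hδ hj a b)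
    (fun a b => norm_apply_le_of_diag_datum hstep hpos hδ hj' a b)
    (fun a b => by simpa only [Matrix.sub_apply] using hdev a b)

/-- **INTENSIVE (MONO-K)₂ FOR DIAGRAMS FROM ONE DIAGONAL-DROP DATUM**: PSD steps and members from `k₀`, a diagonal datum
`δ` at `k₀`, and ONE number `η₀ ≥ re (P k₀ − P j) a a` for all `j ≥ k₀` and all `a` ⟹ for all `j, j′ ≥ k₀`,
`‖F(P j) − F(P j′)‖ ≤ |E|·δ^{|E|−1}·η₀·Σ_x ‖w x‖`. [folklore] -/
theorem norm_diagram_sub_le_of_diag_dev (hstep : ∀ j, k₀ ≤ j → (P j - P (j + 1)).PosSemidef)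
    (hpos : ∀ j, k₀ ≤ j → (P j).PosSemidef) {δ : ℝ} (hδ0 : 0 ≤ δ) (hδ : ∀ a, (P k₀ a a).re ≤ δ) {η₀ : ℝ}
    (hdat : ∀ j, k₀ ≤ j → ∀ a, ((P k₀ - P j) a a).re ≤ η₀) (src tgt : ε → ι) (w : (ι → n) → ℂ) :
    ∀ j j', k₀ ≤ j → k₀ ≤ j' → ‖diagram src tgt w (P j) - diagram src tgt w (P j')‖ ≤
      (Fintype.card ε : ℝ) * δ ^ (Fintype.card ε - 1) * η₀ * ∑ x : ι → n, ‖w x‖ :=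
  fun _ _ hj hj' => norm_diagram_sub_le_of_dev_of_diag_datum hstep hpos hδ0 hδ hj hj'
    (norm_sub_apply_le_of_diag_dev hstep hdat _ _ hj hj') src tgt w

/-- … and to the limit value `F_∞` of the diagram along the chain (which exists,
`NE7LoewnerDiagramBV.exists_tendsto_diagram`): `‖F(P j) − F_∞‖ ≤ |E|·δ^{|E|−1}·η₀·Σ_x ‖w x‖` for every `j ≥ k₀`.
[folklore] -/
theorem norm_diagram_sub_lim_le_of_diag_dev (hstep : ∀ j, k₀ ≤ j → (P j - P (j + 1)).PosSemidef)
    (hpos : ∀ j, k₀ ≤ j → (P j).PosSemidef) {δ : ℝ} (hδ0 : 0 ≤ δ) (hδ : ∀ a, (P k₀ a a).re ≤ δ) {η₀ : ℝ}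
    (hdat : ∀ j, k₀ ≤ j → ∀ a, ((P k₀ - P j) a a).re ≤ η₀) (src tgt : ε → ι) (w : (ι → n) → ℂ) {Finf : ℂ}
    (hlim : Tendsto (fun j => diagram src tgt w (P j)) atTop (𝓝 Finf)) :
    ∀ j, k₀ ≤ j → ‖diagram src tgt w (P j) - Finf‖ ≤
      (Fintype.card ε : ℝ) * δ ^ (Fintype.card ε - 1) * η₀ * ∑ x : ι → n, ‖w x‖ := by
  intro j hj
  have hc : Tendsto (fun j' => ‖diagram src tgt w (P j) - diagram src tgt w (P j')‖) atTop
      (𝓝 ‖diagram src tgt w (P j) - Finf‖) := (tendsto_const_nhds.sub hlim).norm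
  refine le_of_tendsto hc (eventually_atTop.2 ⟨k₀, fun j' hj' => ?_⟩)
  exact norm_diagram_sub_le_of_diag_dev hstep hpos hδ0 hδ hdat src tgt w j j' hj hj'

end Diagrams

/-! ## §3 The unconditional torus plaquette-covariance chain: variances instead of the trace -/

section Plaquette

open Literature.MathematicalPhysics.QuantumFieldTheory.Balaban1983to89.B5Prop11Plancherel (Tor)
open Summit.QuantumFields.BalabanUV.Beta.GAN24.MonotoneTorusPlaquette
  (plaqCov plaqCov_antitone_step plaqCov_posSemidef)

variable {d : ℕ} (Lc : ℕ) [NeZero Lc] (M : Fin d → ℕ) [hM : ∀ μ, NeZero (M μ)]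
variable {c : Type*} [Fintype c] [DecidableEq c]
variable {ε ι : Type*} [Fintype ε] [DecidableEq ε] [Fintype ι] [DecidableEq ι]

/-- **EVERY PLAQUETTE-COVARIANCE ENTRY AT EVERY FINER LEVEL IS BOUNDED BY ONE COARSE VARIANCE BOUND**: if the level-`k₀`
single-plaquette variances satisfy `re plaqCov R k₀ x x ≤ δ` for all plaquettes `x` of the read-out torus, then
`‖plaqCov R j a b‖ ≤ δ` for all `j ≥ k₀` and all `a, b` — NO HYPOTHESIS on the chain (it is `plaqCov_antitone_step` ∕
`plaqCov_posSemidef`). [folklore] -/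
theorem norm_plaqCov_apply_le_of_variance (R : Matrix c (Tor M × Fin d) ℂ) {k₀ : ℕ} {δ : ℝ}
    (hδ : ∀ x, (plaqCov Lc M R k₀ x x).re ≤ δ) {j : ℕ} (hj : k₀ ≤ j) (a b : Fin d × Fin d × Tor M) :
    ‖plaqCov Lc M R j a b‖ ≤ δ :=
  norm_apply_le_of_diag_datum (P := fun j => plaqCov Lc M R j) (k₀ := k₀) (fun j _ => plaqCov_antitone_step Lc M R j)
    (fun j _ => plaqCov_posSemidef Lc M R j) hδ hj a b

/-- **B3-vol′ ON THE PLAQUETTE CHAIN**: for every read-out torus, `Lc ≥ 1`, `d`, constraint matrix `R`, every bound `δ ≥ 0`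
on the coarsest-level single-plaquette variances (`re plaqCov R 0 x x ≤ δ` for all `x`), every finite multigraph and vertex
weight: `Σ_j ‖F(plaqCov R j) − F(plaqCov R (j+1))‖ ≤ |E|·δ^{|E|}·Σ_x ‖w x‖` — the volume of the read-out torus enters through
`Σ_x ‖w x‖` alone (cf. `NE7LoewnerDiagramPlaquette.tsum_norm_diagram_plaqCov_sub_le`: `(re tr plaqCov R 0)^{|E|}`,
`re tr = Σ_x` of the variances). [folklore] -/
theorem tsum_norm_diagram_plaqCov_sub_le_of_variance (R : Matrix c (Tor M × Fin d) ℂ) {δ : ℝ} (hδ0 : 0 ≤ δ)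
    (hδ : ∀ x, (plaqCov Lc M R 0 x x).re ≤ δ) (src tgt : ε → ι) (w : (ι → Fin d × Fin d × Tor M) → ℂ) :
    ∑' j, ‖diagram src tgt w (plaqCov Lc M R j) - diagram src tgt w (plaqCov Lc M R (j + 1))‖ ≤
      (Fintype.card ε : ℝ) * δ ^ Fintype.card ε * ∑ x : ι → Fin d × Fin d × Tor M, ‖w x‖ :=
  tsum_norm_diagram_sub_le_of_diag_datum (P := fun j => plaqCov Lc M R j) (k₀ := 0)
    (fun j _ => plaqCov_antitone_step Lc M R j) (fun j _ => plaqCov_posSemidef Lc M R j) hδ0 hδ src tgt w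

/-- **INTENSIVE (MONO-K)₂ FOR PLAQUETTE DIAGRAMS FROM THE SINGLE-PLAQUETTE VARIANCE DROP — NO RATE.**  A variance bound `δ ≥ 0`
at level `k₀` and ONE number `η₀` with `re (plaqCov R k₀ − plaqCov R j) x x ≤ η₀` for all `j ≥ k₀` and all plaquettes `x`
(how much ONE plaquette's variance can still drop after `k₀` — a computation at level `k₀` against the monotone limit of
`MonotoneTorusPlaquette.plaqCov_diag_antitone`) band EVERY diagram between any two depths `j, j′ ≥ k₀`:
`‖F(plaqCov R j) − F(plaqCov R j′)‖ ≤ |E|·δ^{|E|−1}·η₀·Σ_x ‖w x‖`. [folklore] -/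
theorem norm_diagram_plaqCov_sub_le_of_variance_drop (R : Matrix c (Tor M × Fin d) ℂ) {k₀ : ℕ} {δ η₀ : ℝ}
    (hδ0 : 0 ≤ δ) (hδ : ∀ x, (plaqCov Lc M R k₀ x x).re ≤ δ)
    (hdrop : ∀ j, k₀ ≤ j → ∀ x, ((plaqCov Lc M R k₀ - plaqCov Lc M R j) x x).re ≤ η₀) (src tgt : ε → ι)
    (w : (ι → Fin d × Fin d × Tor M) → ℂ) :
    ∀ j j', k₀ ≤ j → k₀ ≤ j' →
      ‖diagram src tgt w (plaqCov Lc M R j) - diagram src tgt w (plaqCov Lc M R j')‖ ≤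
        (Fintype.card ε : ℝ) * δ ^ (Fintype.card ε - 1) * η₀ * ∑ x : ι → Fin d × Fin d × Tor M, ‖w x‖ :=
  norm_diagram_sub_le_of_diag_dev (P := fun j => plaqCov Lc M R j) (k₀ := k₀)
    (fun j _ => plaqCov_antitone_step Lc M R j) (fun j _ => plaqCov_posSemidef Lc M R j) hδ0 hδ hdrop src tgt w

/-- … and to the refinement LIMIT `F_∞` (which exists unconditionally, `NE7LoewnerDiagramPlaquette.exists_tendsto_diagram_plaqCov`):
`‖F(plaqCov R j) − F_∞‖ ≤ |E|·δ^{|E|−1}·η₀·Σ_x ‖w x‖` for every `j ≥ k₀`. [folklore] -/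
theorem norm_diagram_plaqCov_sub_lim_le_of_variance_drop (R : Matrix c (Tor M × Fin d) ℂ) {k₀ : ℕ} {δ η₀ : ℝ}
    (hδ0 : 0 ≤ δ) (hδ : ∀ x, (plaqCov Lc M R k₀ x x).re ≤ δ)
    (hdrop : ∀ j, k₀ ≤ j → ∀ x, ((plaqCov Lc M R k₀ - plaqCov Lc M R j) x x).re ≤ η₀) (src tgt : ε → ι)
    (w : (ι → Fin d × Fin d × Tor M) → ℂ) {Finf : ℂ}
    (hlim : Tendsto (fun j => diagram src tgt w (plaqCov Lc M R j)) atTop (𝓝 Finf)) :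
    ∀ j, k₀ ≤ j → ‖diagram src tgt w (plaqCov Lc M R j) - Finf‖ ≤
      (Fintype.card ε : ℝ) * δ ^ (Fintype.card ε - 1) * η₀ * ∑ x : ι → Fin d × Fin d × Tor M, ‖w x‖ :=
  norm_diagram_sub_lim_le_of_diag_dev (P := fun j => plaqCov Lc M R j) (k₀ := k₀)
    (fun j _ => plaqCov_antitone_step Lc M R j) (fun j _ => plaqCov_posSemidef Lc M R j) hδ0 hδ hdrop src tgt w hlim

end Plaquette

/-! ## §4 The soft (Gaussian-weighted) constraint chain: the same three -/

section Soft

open Literature.MathematicalPhysics.QuantumFieldTheory.Balaban1983to89.B5Prop11Plancherel (Tor)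
open Summit.QuantumFields.BalabanUV.Beta.GAN24.MonotoneTorusSoft
  (softPlaqCov softPlaqCov_antitone_step softPlaqCov_posSemidef)

variable {d : ℕ} (Lc : ℕ) [NeZero Lc] (M : Fin d → ℕ) [hM : ∀ μ, NeZero (M μ)]
variable {cs : Type*} [Fintype cs] {ch : Type*} [Fintype ch] [DecidableEq ch]
variable {ε ι : Type*} [Fintype ε] [DecidableEq ε] [Fintype ι] [DecidableEq ι]

/-- Every entry of the soft plaquette covariance at every step `j ≥ k₀` is bounded by any bound `δ` on the step-`k₀`
single-plaquette variances (weight `a′ ≥ 0`, soft rows `Rₛ`, hard rows `R_h`). [folklore] -/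
theorem norm_softPlaqCov_apply_le_of_variance (Rs : Matrix cs (Tor M × Fin d) ℂ) {a' : ℝ} (ha' : 0 ≤ a')
    (Rh : Matrix ch (Tor M × Fin d) ℂ) {k₀ : ℕ} {δ : ℝ} (hδ : ∀ x, (softPlaqCov Lc M k₀ Rs a' Rh x x).re ≤ δ) {j : ℕ}
    (hj : k₀ ≤ j) (a b : Fin d × Fin d × Tor M) : ‖softPlaqCov Lc M j Rs a' Rh a b‖ ≤ δ :=
  norm_apply_le_of_diag_datum (P := fun k => softPlaqCov Lc M k Rs a' Rh) (k₀ := k₀)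
    (fun k _ => softPlaqCov_antitone_step Lc M k Rs ha' Rh) (fun k _ => softPlaqCov_posSemidef Lc M k Rs ha' Rh) hδ hj a b

/-- **B3-vol′ ON THE SOFT CHAIN**: `Σ_k ‖F(softPlaqCov k) − F(softPlaqCov (k+1))‖ ≤ |E|·δ^{|E|}·Σ_x ‖w x‖` for every bound
`δ ≥ 0` on the step-`0` single-plaquette variances. [folklore] -/
theorem tsum_norm_diagram_softPlaqCov_sub_le_of_variance (Rs : Matrix cs (Tor M × Fin d) ℂ) {a' : ℝ} (ha' : 0 ≤ a')
    (Rh : Matrix ch (Tor M × Fin d) ℂ) {δ : ℝ} (hδ0 : 0 ≤ δ) (hδ : ∀ x, (softPlaqCov Lc M 0 Rs a' Rh x x).re ≤ δ)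
    (src tgt : ε → ι) (w : (ι → Fin d × Fin d × Tor M) → ℂ) :
    ∑' k, ‖diagram src tgt w (softPlaqCov Lc M k Rs a' Rh) - diagram src tgt w (softPlaqCov Lc M (k + 1) Rs a' Rh)‖ ≤
      (Fintype.card ε : ℝ) * δ ^ Fintype.card ε * ∑ x : ι → Fin d × Fin d × Tor M, ‖w x‖ :=
  tsum_norm_diagram_sub_le_of_diag_datum (P := fun k => softPlaqCov Lc M k Rs a' Rh) (k₀ := 0)
    (fun k _ => softPlaqCov_antitone_step Lc M k Rs ha' Rh) (fun k _ => softPlaqCov_posSemidef Lc M k Rs ha' Rh)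
    hδ0 hδ src tgt w

/-- **INTENSIVE (MONO-K)₂ FOR SOFT PLAQUETTE DIAGRAMS FROM THE SINGLE-PLAQUETTE VARIANCE DROP**: variance bound `δ ≥ 0` at
step `k₀` and `re (softPlaqCov k₀ − softPlaqCov j) x x ≤ η₀` for all `j ≥ k₀`, all `x` ⟹ band
`|E|·δ^{|E|−1}·η₀·Σ_x ‖w x‖` between any two steps `≥ k₀`. [folklore] -/
theorem norm_diagram_softPlaqCov_sub_le_of_variance_drop (Rs : Matrix cs (Tor M × Fin d) ℂ) {a' : ℝ} (ha' : 0 ≤ a')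
    (Rh : Matrix ch (Tor M × Fin d) ℂ) {k₀ : ℕ} {δ η₀ : ℝ} (hδ0 : 0 ≤ δ)
    (hδ : ∀ x, (softPlaqCov Lc M k₀ Rs a' Rh x x).re ≤ δ)
    (hdrop : ∀ j, k₀ ≤ j → ∀ x, ((softPlaqCov Lc M k₀ Rs a' Rh - softPlaqCov Lc M j Rs a' Rh) x x).re ≤ η₀)
    (src tgt : ε → ι) (w : (ι → Fin d × Fin d × Tor M) → ℂ) :
    ∀ j j', k₀ ≤ j → k₀ ≤ j' →
      ‖diagram src tgt w (softPlaqCov Lc M j Rs a' Rh) - diagram src tgt w (softPlaqCov Lc M j' Rs a' Rh)‖ ≤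
        (Fintype.card ε : ℝ) * δ ^ (Fintype.card ε - 1) * η₀ * ∑ x : ι → Fin d × Fin d × Tor M, ‖w x‖ :=
  norm_diagram_sub_le_of_diag_dev (P := fun k => softPlaqCov Lc M k Rs a' Rh) (k₀ := k₀)
    (fun k _ => softPlaqCov_antitone_step Lc M k Rs ha' Rh) (fun k _ => softPlaqCov_posSemidef Lc M k Rs ha' Rh)
    hδ0 hδ hdrop src tgt w

/-- … and to the limit `F_∞` of `NE7LoewnerDiagramPlaquette.exists_tendsto_diagram_softPlaqCov`, for every `j ≥ k₀`.
[folklore] -/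
theorem norm_diagram_softPlaqCov_sub_lim_le_of_variance_drop (Rs : Matrix cs (Tor M × Fin d) ℂ) {a' : ℝ}
    (ha' : 0 ≤ a') (Rh : Matrix ch (Tor M × Fin d) ℂ) {k₀ : ℕ} {δ η₀ : ℝ} (hδ0 : 0 ≤ δ)
    (hδ : ∀ x, (softPlaqCov Lc M k₀ Rs a' Rh x x).re ≤ δ)
    (hdrop : ∀ j, k₀ ≤ j → ∀ x, ((softPlaqCov Lc M k₀ Rs a' Rh - softPlaqCov Lc M j Rs a' Rh) x x).re ≤ η₀)
    (src tgt : ε → ι) (w : (ι → Fin d × Fin d × Tor M) → ℂ) {Finf : ℂ}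
    (hlim : Tendsto (fun k => diagram src tgt w (softPlaqCov Lc M k Rs a' Rh)) atTop (𝓝 Finf)) :
    ∀ j, k₀ ≤ j → ‖diagram src tgt w (softPlaqCov Lc M j Rs a' Rh) - Finf‖ ≤
      (Fintype.card ε : ℝ) * δ ^ (Fintype.card ε - 1) * η₀ * ∑ x : ι → Fin d × Fin d × Tor M, ‖w x‖ :=
  norm_diagram_sub_lim_le_of_diag_dev (P := fun k => softPlaqCov Lc M k Rs a' Rh) (k₀ := k₀)
    (fun k _ => softPlaqCov_antitone_step Lc M k Rs ha' Rh) (fun k _ => softPlaqCov_posSemidef Lc M k Rs ha' Rh)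
    hδ0 hδ hdrop src tgt w hlim

end Soft

end Summit.QuantumFields.BalabanUV.T4Continuum.NE7LoewnerDiagramBVIntensive

end
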